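import Summits.QuantumFields.YangMills.Theorems.BalabanUVNodesN16HolderMultiScaleRates
import HarnessLib

/-!
# Route «BalabanUVNodes», cluster K4 «SpineRates» — node N16 = NE3: THE COVARIANT ROOT WITH THE MULTI-SCALE (3.40) HÖLDER MEMBER AT EXPONENT `β`,
# NAMED (`CovRootHolderMS`), its analogue of the venue decl `N16At` (`N16HolderMSAt`) and of the stub `S_N16` (`S_N16HolderMS`) — the CANDIDATE
# WORDINGS of repair R-β″ (window-free Hölder road); each implies generation 3's β-wording (`CovRootHolder` ∕ `N16HolderAt` ∕ `S_N16Holder`)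

Cell `pub-ymgap`, seat `pub-ymgap-dag-n16-c` (R134 fan-out seat, strategy s1; HUMAN RULING D-0062; chair R424 venue), generation 4, file 22 — the DEFINITIONS of
repair R-β″ of the located item «the Hölder-exponent pin of N16's N05-socket» (`HOME/pub-ymgap-dag-n16-c/LOCATED-N16-HOLDER-PIN.md`, census row R-β″ = ADDENDUM 3
(iii); pub-ymgap INBOX DAGN16C-G4-STARTED∕INTENT-1∕FILED-1).  `--supports stmt-QuantumFields-19912` (K3‴ `SpineGivenEndpointR13`, route rev 16; definition lane).
`bears_on: R4∕N16 · edge N05 → N16 · out-edges N16 → N19∕N21`.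

WHY.  Generation 3 named the β-root `N16HolderDefs.CovRootHolder d 𝒞 L N b g C Λ₁ Λ₂' β dom`: the covariant root of record with its third conjunct (Lip₂′ᶜ) at
`ξ^{2+β}` — print's (1.36) Hölder member read at NEAREST-NEIGHBOUR separation; NE7's consumer then needs `β > 2∕3` (`N16HolderWindow`).  Files 20∕21
(`N16HolderMultiScale` ∕ `…Rates`) showed in kernel that reading the same member as PRINTED — [Balaban1985BackgroundPropagators] (3.40), the transported quotient over
ALL pairs up to unit distance, here along lattice lines with the line holonomy as transport — removes the window: (Gᶜ)∕(C)∕(Q) at `(θ^k)^{(12+14β)∕(1+β)}`, below the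
margin for every `β > 0`.  THIS FILE names the corresponding root, venue-decl analogue and stub analogue, so that the ruling «R-β ∕ R-β″ ∕ R-Δ ∕ R-min» can cite ONE
token per level (`N16At ↦ N16HolderMSAt · β`, `S_N16 ↦ S_N16HolderMS β`), and records that each MS wording IMPLIES the β-wording of generation 3 (so the producer
column `N16HolderConst ∕ OfThm4Output ∕ OfLeaf`, the record kit `N16HolderRegime ∕ LeafSlot`, N21's `N21HolderWidth` and N19's `N19LiaisonC1Holder` remain consumers
of the MS wording through `CovRootHolder`).  Definitions + `Iff.rfl`-level API; nothing of record is edited; nothing is asserted for any bundle.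

CONTENTS.  §1 `CovRootHolderMS` (β-root with the multi-scale third conjunct), `covRootHolderMS_iff`, `.perPair`, `.mono`, `covRootHolder_of_covRootHolderMS`
(`L ≥ 1`; = file 20's `covRootHolder_of_covRootMS`), `ne3EnergyRateWCov_of_covRootHolderMS_one` (at `β = 1` the MS root implies the root of record),
`closeness_of_covRootHolderMS` (file 21's consumer END by name).  §2 `N16HolderMSAt c β`, `n16HolderMSAt_iff`, `n16HolderAt_of_n16HolderMSAt`, `n16At_of_n16HolderMSAt_one`.
§3 `S_N16HolderMS β RRec`, `s_N16HolderMS_iff`, `s_N16Holder_of_s_N16HolderMS`, `s_N16_of_s_N16HolderMS_one`.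
HONEST FRAMING: definitions of hypothesis∕target SHAPES + `Iff.rfl`-level bookkeeping; nothing of Bałaban's proved; the located item is a PLANNER∕director
question (R-β ∕ R-β″ ∕ R-Δ ∕ R-min); N16 ∕ NE3 NOT discharged; count-neutral; one finite T⁴ at fixed ε — NOT ℝ⁴, NOT infinite volume, NOT OS, NOT a mass gap, NOT Clay.
-/

set_option autoImplicit false

open scoped BigOperators Matrix Matrix.Norms.L2Operator

namespace Summit.QuantumFields.YangMills.BalabanUVNodes.N16HolderMSDefs

open Literature.MathematicalPhysics.QuantumFieldTheory.Balaban1983to89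
open B7Prop1Explicit B7Prop2Explicit
open T4AveragingDeficitWall hiding Site Plane Plaq Bond
open T4AveragingDeficitWallBoundary (periodBox)
open Summit.QuantumFields.BalabanUV.T4Continuum
open AveragingDeficitPeriodicCounting (IsPeriodicDir)
open AveragingDeficitDualResidual (dualC1 dualC2)
open AveragingDeficitDerivWallProof (wallConst)
open MinimalActionSandwich (IsMinimiser)
open MinimalActionRate (Regular sfClass)
open NE3EnergyShapes (residualScale residualScale_nonneg IsUnitarySite IsPeriodicSite)
open NE3EnergyWeightedShapes (energyNormW)
open NE3EnergyWeightedCovShape (NE3EnergyRateWCov)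
open Literature.MathematicalPhysics.QuantumFieldTheory.Balaban1983to89.T4Continuum (T4Family ULoop)
open YMDAG.UVSplit (NE3Carriers RateCarriers RateRecordPred Datum N16At S_N16)
open N16HolderDefs (CovRootHolder N16HolderAt S_N16Holder ne3EnergyRateWCov_of_covRootHolder_one n16HolderAt_one_iff s_N16Holder_one_iff)
open N16HolderMultiScale (covRootHolder_of_covRootMS)
open N16HolderMultiScaleRates (closeness_of_covRoot_holderMS)

noncomputable section

variable {d : ℕ} {n : Type*} [Fintype n] [DecidableEq n]

/-! ## §1 The covariant root with the MULTI-SCALE Hölder member at exponent `β` -/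

variable (d) in
/-- **T-E_w^cov WITH THE MULTI-SCALE (3.40) HÖLDER MEMBER AT EXPONENT `β` — THE MS β-ROOT** (a `Prop`; asserted for no class here): VERBATIM
`N16HolderDefs.CovRootHolder d 𝒞 L N b g C Λ₁ Λ₂' β dom` — for every level `k ≥ 1`, datum `V ∈ dom` and minimiser pair `(U_A, U_B)` with `U_B` regular: `∃ (u, Z)`
unitary∕periodic, skew∕periodic, `gaugeAct u U_A = vary W Z 1` (`W := rescale L (bavg L U_B)`), the η-weighted energy bound `≤ C·residualScale`, (Lip₁ᶜ) `≤ Λ₁·ξ²`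
— EXCEPT that the third covariant conjunct is the MULTI-SCALE member (Lip₂ᴹˢ)_β: for every lattice line (`κ μ : Fin d`, base `y`) and every separation
`1 ≤ j ≤ L^k`, the covariant difference `Ad (W (y + e κ + j•e μ) μ) (Z (y + (j+1)•e μ) κ) − Z (y + j•e μ) κ` transported back to `y` by the line holonomy
`W (y+e κ) μ · W (y+e κ+e μ) μ ⋯ W (y+e κ+(j−1)•e μ) μ` differs from `Ad (W (y + e κ) μ) (Z (y + e μ) κ) − Z y κ` by at most `Λ₂′·ξ^{(2:ℝ)+β}·j^β`
(`ξ := ((L:ℝ)⁻¹)^k`, real powers) — the reading ALONG LINES of [Balaban1985BackgroundPropagators] (3.40) «‖∇A‖_α = max_{μ,ν} sup_{x,x′:|x−x′|≦1}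
|x′ − x|^{−α}|R(U(Γ_{x,x′}))(D_μA_ν)(x′) − (D_μA_ν)(x)|» (all pairs up to unit distance = `L^k` lattice steps; along a line the shortest contour is the line and
its transport the line holonomy), i.e. of the (1.36) Hölder member of [Balaban1985RegularSpaces] Theorem 2 «β ≦ β₀ < 1» at the pair.  At `j = 1` it is
generation 3's nearest-neighbour (Lip₂′ᶜ)_β (`covRootHolder_of_covRootHolderMS`).  The inline hypothesis `h` of
`N16HolderMultiScaleRates.closeness_of_covRoot_holderMS` is this `Prop` unfolded.  A hypothesis∕target SHAPE.
[cite: Balaban1985BackgroundPropagators, (3.40) p.397; Balaban1985RegularSpaces, (1.36) p.82] -/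
@[folklore]
def CovRootHolderMS (𝒞 : ℕ → Set (Site d → Fin d → (Matrix n n ℂ)ˣ)) (L N : ℕ) (b g C Λ₁ Λ₂' β : ℝ)
    (dom : Set (Site d → Fin d → (Matrix n n ℂ)ˣ)) : Prop :=
  ∀ k : ℕ, 1 ≤ k → ∀ V ∈ dom, ∀ UA UB : Site d → Fin d → (Matrix n n ℂ)ˣ,
    IsMinimiser d 𝒞 L N k V UA → IsMinimiser d 𝒞 L N (k + 1) V UB → Regular d L N b g (k + 1) UB →
      ∃ (u : Site d → (Matrix n n ℂ)ˣ) (Z : Site d → Fin d → Matrix n n ℂ),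
        IsUnitarySite u ∧ IsPeriodicSite u ((N * L ^ k : ℕ) : ℤ) ∧
        IsSkewDir Z ∧ IsPeriodicDir Z ((N * L ^ k : ℕ) : ℤ) ∧
        gaugeAct u UA = vary (rescale L (bavg L UB)) Z 1 ∧
        energyNormW L k (rescale L (bavg L UB)) Z (periodBox (N * L ^ k)) ≤ C * residualScale d L N b g k ∧
        (∀ (κ : Fin d) (x : Site d) (μ : Fin d),
          ‖Ad (rescale L (bavg L UB) (x + e κ) μ) (Z (x + e μ) κ) - Z x κ‖ ≤ Λ₁ * (((L : ℝ)⁻¹) ^ k) ^ 2) ∧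
        (∀ (κ μ : Fin d) (y : Site d) (j : ℕ), 1 ≤ j → j ≤ L ^ k →
          ‖Ad (((List.range j).map fun i : ℕ => rescale L (bavg L UB) (y + e κ + i • e μ) μ).prod)
                (Ad (rescale L (bavg L UB) (y + e κ + j • e μ) μ) (Z (y + (j + 1) • e μ) κ) - Z (y + j • e μ) κ)
            - (Ad (rescale L (bavg L UB) (y + e κ) μ) (Z (y + e μ) κ) - Z y κ)‖
            ≤ Λ₂' * (((L : ℝ)⁻¹) ^ k) ^ ((2 : ℝ) + β) * (j : ℝ) ^ β)

/-- `CovRootHolderMS` unfolded (`Iff.rfl`). [folklore] -/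
theorem covRootHolderMS_iff {𝒞 : ℕ → Set (Site d → Fin d → (Matrix n n ℂ)ˣ)} {L N : ℕ} {b g C Λ₁ Λ₂' β : ℝ}
    {dom : Set (Site d → Fin d → (Matrix n n ℂ)ˣ)} :
    CovRootHolderMS d 𝒞 L N b g C Λ₁ Λ₂' β dom ↔
      ∀ k : ℕ, 1 ≤ k → ∀ V ∈ dom, ∀ UA UB : Site d → Fin d → (Matrix n n ℂ)ˣ,
        IsMinimiser d 𝒞 L N k V UA → IsMinimiser d 𝒞 L N (k + 1) V UB → Regular d L N b g (k + 1) UB →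
          ∃ (u : Site d → (Matrix n n ℂ)ˣ) (Z : Site d → Fin d → Matrix n n ℂ),
            IsUnitarySite u ∧ IsPeriodicSite u ((N * L ^ k : ℕ) : ℤ) ∧
            IsSkewDir Z ∧ IsPeriodicDir Z ((N * L ^ k : ℕ) : ℤ) ∧
            gaugeAct u UA = vary (rescale L (bavg L UB)) Z 1 ∧
            energyNormW L k (rescale L (bavg L UB)) Z (periodBox (N * L ^ k)) ≤ C * residualScale d L N b g k ∧
            (∀ (κ : Fin d) (x : Site d) (μ : Fin d),
              ‖Ad (rescale L (bavg L UB) (x + e κ) μ) (Z (x + e μ) κ) - Z x κ‖ ≤ Λ₁ * (((L : ℝ)⁻¹) ^ k) ^ 2) ∧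
            (∀ (κ μ : Fin d) (y : Site d) (j : ℕ), 1 ≤ j → j ≤ L ^ k →
              ‖Ad (((List.range j).map fun i : ℕ => rescale L (bavg L UB) (y + e κ + i • e μ) μ).prod)
                    (Ad (rescale L (bavg L UB) (y + e κ + j • e μ) μ) (Z (y + (j + 1) • e μ) κ) - Z (y + j • e μ) κ)
                - (Ad (rescale L (bavg L UB) (y + e κ) μ) (Z (y + e μ) κ) - Z y κ)‖
                ≤ Λ₂' * (((L : ℝ)⁻¹) ^ k) ^ ((2 : ℝ) + β) * (j : ℝ) ^ β) :=
  Iff.rfl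

/-- The per-pair body of the MS β-root. [folklore] -/
theorem CovRootHolderMS.perPair {𝒞 : ℕ → Set (Site d → Fin d → (Matrix n n ℂ)ˣ)} {L N : ℕ} {b g C Λ₁ Λ₂' β : ℝ}
    {dom : Set (Site d → Fin d → (Matrix n n ℂ)ˣ)} (h : CovRootHolderMS d 𝒞 L N b g C Λ₁ Λ₂' β dom)
    {k : ℕ} (hk : 1 ≤ k) {V : Site d → Fin d → (Matrix n n ℂ)ˣ} (hV : V ∈ dom) {UA UB : Site d → Fin d → (Matrix n n ℂ)ˣ}
    (hA : IsMinimiser d 𝒞 L N k V UA) (hB : IsMinimiser d 𝒞 L N (k + 1) V UB) (hreg : Regular d L N b g (k + 1) UB) :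
    ∃ (u : Site d → (Matrix n n ℂ)ˣ) (Z : Site d → Fin d → Matrix n n ℂ),
      IsUnitarySite u ∧ IsPeriodicSite u ((N * L ^ k : ℕ) : ℤ) ∧
      IsSkewDir Z ∧ IsPeriodicDir Z ((N * L ^ k : ℕ) : ℤ) ∧
      gaugeAct u UA = vary (rescale L (bavg L UB)) Z 1 ∧
      energyNormW L k (rescale L (bavg L UB)) Z (periodBox (N * L ^ k)) ≤ C * residualScale d L N b g k ∧
      (∀ (κ : Fin d) (x : Site d) (μ : Fin d),
        ‖Ad (rescale L (bavg L UB) (x + e κ) μ) (Z (x + e μ) κ) - Z x κ‖ ≤ Λ₁ * (((L : ℝ)⁻¹) ^ k) ^ 2) ∧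
      (∀ (κ μ : Fin d) (y : Site d) (j : ℕ), 1 ≤ j → j ≤ L ^ k →
        ‖Ad (((List.range j).map fun i : ℕ => rescale L (bavg L UB) (y + e κ + i • e μ) μ).prod)
              (Ad (rescale L (bavg L UB) (y + e κ + j • e μ) μ) (Z (y + (j + 1) • e μ) κ) - Z (y + j • e μ) κ)
          - (Ad (rescale L (bavg L UB) (y + e κ) μ) (Z (y + e μ) κ) - Z y κ)‖
          ≤ Λ₂' * (((L : ℝ)⁻¹) ^ k) ^ ((2 : ℝ) + β) * (j : ℝ) ^ β) :=
  h k hk V hV UA UB hA hB hreg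

/-- The MS β-root is monotone in the three constants `C ≤ C′`, `Λ₁ ≤ Λ₁′`, `Λ₂′ ≤ Λ₂″`. [folklore] -/
theorem CovRootHolderMS.mono {𝒞 : ℕ → Set (Site d → Fin d → (Matrix n n ℂ)ˣ)} {L N : ℕ} {b g C C' Λ₁ Λ₁' Λ₂' Λ₂'' β : ℝ}
    {dom : Set (Site d → Fin d → (Matrix n n ℂ)ˣ)} (h : CovRootHolderMS d 𝒞 L N b g C Λ₁ Λ₂' β dom) (hC : C ≤ C') (hΛ₁ : Λ₁ ≤ Λ₁')
    (hΛ₂ : Λ₂' ≤ Λ₂'') : CovRootHolderMS d 𝒞 L N b g C' Λ₁' Λ₂'' β dom := by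
  intro k hk V hV UA UB hA hB hreg
  obtain ⟨u, Z, hu, huP, hZ, hZP, hrep, hE, h1, h2⟩ := h k hk V hV UA UB hA hB hreg
  have hξ : 0 ≤ ((L : ℝ)⁻¹) ^ k := pow_nonneg (inv_nonneg.mpr (Nat.cast_nonneg L)) k
  refine ⟨u, Z, hu, huP, hZ, hZP, hrep, hE.trans ?_, fun κ x μ => (h1 κ x μ).trans ?_, fun κ μ y j hj hjL => (h2 κ μ y j hj hjL).trans ?_⟩
  · exact mul_le_mul_of_nonneg_right hC (residualScale_nonneg d L N b g k)
  · exact mul_le_mul_of_nonneg_right hΛ₁ (pow_nonneg hξ 2)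
  · exact mul_le_mul_of_nonneg_right (mul_le_mul_of_nonneg_right hΛ₂ (Real.rpow_nonneg hξ _)) (Real.rpow_nonneg (Nat.cast_nonneg j) β)

/-- **THE MS β-ROOT IMPLIES THE β-ROOT** (`L ≥ 1`): its (Lip₂′ᶜ)_β is the multi-scale member at `j = 1 ≤ L^k` (file 20's `covRootHolder_of_covRootMS`).
[folklore] -/
theorem covRootHolder_of_covRootHolderMS {𝒞 : ℕ → Set (Site d → Fin d → (Matrix n n ℂ)ˣ)} {L N : ℕ} (hL : 1 ≤ L) {b g C Λ₁ Λ₂' β : ℝ}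
    {dom : Set (Site d → Fin d → (Matrix n n ℂ)ˣ)} (h : CovRootHolderMS d 𝒞 L N b g C Λ₁ Λ₂' β dom) :
    CovRootHolder d 𝒞 L N b g C Λ₁ Λ₂' β dom :=
  covRootHolder_of_covRootMS hL h

/-- **AT `β = 1` THE MS ROOT IMPLIES THE ROOT OF RECORD** (`L ≥ 1`): MS root at `1` ⇒ β-root at `1` ⇔ `NE3EnergyRateWCov` (`N16HolderDefs.covRootHolder_one_iff`).
[folklore] -/
theorem ne3EnergyRateWCov_of_covRootHolderMS_one {𝒞 : ℕ → Set (Site d → Fin d → (Matrix n n ℂ)ˣ)} {L N : ℕ} (hL : 1 ≤ L) {b g C Λ₁ Λ₂' : ℝ}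
    {dom : Set (Site d → Fin d → (Matrix n n ℂ)ˣ)} (h : CovRootHolderMS d 𝒞 L N b g C Λ₁ Λ₂' 1 dom) :
    NE3EnergyRateWCov d 𝒞 L N b g C Λ₁ Λ₂' dom :=
  ne3EnergyRateWCov_of_covRootHolder_one (covRootHolder_of_covRootHolderMS hL h)

/-- **NE7's CONSUMER-SIDE END FROM THE MS β-ROOT BY NAME** (`d = 4`; file 21's `closeness_of_covRoot_holderMS` with `h : CovRootHolderMS 4 𝒞 L N b g C Λ₁ Λ₂' β dom`):
(P) `θ^{8k}`, (Gᶜ)∕(C)∕(Q) at `(θ^k)^{(12+14β)∕(1+β)}` — below the plaquette margin for every `β > 0`. [folklore] -/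
theorem closeness_of_covRootHolderMS [Nonempty n] {𝒞 : ℕ → Set (Site 4 → Fin 4 → (Matrix n n ℂ)ˣ)} {L N : ℕ} (hL : 2 ≤ L)
    (hN : 1 ≤ N) {θ : ℝ} (hθ : 0 < θ) (hθ6 : θ ^ 6 = ((L : ℝ))⁻¹) {b g C Λ₁ Λ₂' β : ℝ} (hb : 0 ≤ b)
    (hbs : 512 * (4 + 1) * (4 + 4) * (L : ℝ) ^ 2 * b ≤ 1) (hg : 0 ≤ g) (hC : 0 ≤ C) (hΛ₂' : 0 ≤ Λ₂') (hβ0 : 0 ≤ β) (hβ1 : β ≤ 1)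
    {dom : Set (Site 4 → Fin 4 → (Matrix n n ℂ)ˣ)} (h : CovRootHolderMS 4 𝒞 L N b g C Λ₁ Λ₂' β dom)
    {γ l₁ : ℝ} (hγ : 0 < γ)
    (hγ3 : C * (wallConst 4 L * (N : ℝ) ^ 2 * (Real.sqrt g * dualC2 4 L + 2 * b ^ 2 * dualC1 4 L)) ≤ γ ^ 3)
    (hl₁ : 0 < l₁) (hΛl₁ : Λ₁ ≤ l₁ ^ 3)
    {k : ℕ} (hk : 1 ≤ k) (hfit : γ * (θ ^ k) ^ 2 ≤ l₁ * N)
    {V : Site 4 → Fin 4 → (Matrix n n ℂ)ˣ} (hV : V ∈ dom) {UA UB : Site 4 → Fin 4 → (Matrix n n ℂ)ˣ}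
    (hA : IsMinimiser 4 𝒞 L N k V UA) (hB : IsMinimiser 4 𝒞 L N (k + 1) V UB) (hreg : Regular 4 L N b g (k + 1) UB) :
    ∃ (u : Site 4 → (Matrix n n ℂ)ˣ) (Z : Site 4 → Fin 4 → Matrix n n ℂ),
      IsUnitarySite u ∧ IsPeriodicSite u ((N * L ^ k : ℕ) : ℤ) ∧ IsSkewDir Z ∧ IsPeriodicDir Z ((N * L ^ k : ℕ) : ℤ) ∧
      gaugeAct u UA = vary (rescale L (bavg L UB)) Z 1 ∧
      (∀ (x : Site 4) (κ : Fin 4), ‖Z x κ‖ ≤ 8 * l₁ ^ 2 * γ * θ ^ (8 * k)) ∧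
      (∀ (x : Site 4) (μ κ : Fin 4),
        ‖Ad (rescale L (bavg L UB) (x + e κ) μ) (Z (x + e μ) κ) - Z x κ‖
          ≤ (32 * l₁ ^ 2 * γ + 2 * Λ₂') * (θ ^ k) ^ (((12 : ℝ) + 14 * β) / (1 + β))) ∧
      (∀ (π : T4AveragingDeficitWall.Plane 4) (x : Site 4),
        ‖curl (rescale L (bavg L UB)) Z (x, π)‖
          ≤ 2 * ((32 * l₁ ^ 2 * γ + 2 * Λ₂') * (θ ^ k) ^ (((12 : ℝ) + 14 * β) / (1 + β)))) ∧
      (∀ (z : Site 4) (μ ν : Fin 4),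
        ‖((hol (gaugeAct u UA) z (plaqWord μ ν) : (Matrix n n ℂ)ˣ) : Matrix n n ℂ)
            - ((hol (rescale L (bavg L UB)) z (plaqWord μ ν) : (Matrix n n ℂ)ˣ) : Matrix n n ℂ)‖
          ≤ (2 * (32 * l₁ ^ 2 * γ + 2 * Λ₂') + 1536 * l₁ ^ 4 * γ ^ 2 * Real.exp (8 * l₁ ^ 2 * γ))
              * (θ ^ k) ^ (((12 : ℝ) + 14 * β) / (1 + β))) :=
  closeness_of_covRoot_holderMS hL hN hθ hθ6 hb hbs hg hC hΛ₂' hβ0 hβ1 (covRootHolderMS_iff.mp h) hγ hγ3 hl₁ hΛl₁ hk hfit hV hA hB hreg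

/-! ## §2 The MS analogue of the venue decl `N16At` (CANDIDATE wording of R-β″; nothing of record edited) -/

/-- **N16 · NE3 ON ITS CARRIERS WITH THE MULTI-SCALE HÖLDER MEMBER AT EXPONENT `β`** — the R-β″ analogue of the venue decl `YMDAG.UVSplit.N16At c`:
`CovRootHolderMS 4 (sfClass 4 c.L c.Nper c.ε) c.L c.Nper c.b c.g c.C c.Λ₁ c.Λ₂' β c.dom` at colour `Fin N`.  Implies generation 3's `N16HolderAt c β` (below).
A CANDIDATE wording (statement edits are the planner's; `N16At` is untouched); a hypothesis∕target SHAPE asserted for no bundle. [folklore] -/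
@[folklore]
def N16HolderMSAt {N : ℕ} (c : NE3Carriers N) (β : ℝ) : Prop :=
  CovRootHolderMS 4 (sfClass 4 c.L c.Nper c.ε) c.L c.Nper c.b c.g c.C c.Λ₁ c.Λ₂' β c.dom

/-- `N16HolderMSAt c β` unfolded one step (`Iff.rfl`). [folklore] -/
theorem n16HolderMSAt_iff {N : ℕ} (c : NE3Carriers N) (β : ℝ) :
    N16HolderMSAt c β ↔ CovRootHolderMS 4 (sfClass 4 c.L c.Nper c.ε) c.L c.Nper c.b c.g c.C c.Λ₁ c.Λ₂' β c.dom :=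
  Iff.rfl

/-- **`N16HolderMSAt c β` IMPLIES `N16HolderAt c β`** (`c.L ≥ 1`). [folklore] -/
theorem n16HolderAt_of_n16HolderMSAt {N : ℕ} {c : NE3Carriers N} {β : ℝ} (h : N16HolderMSAt c β) (hL : 1 ≤ c.L) :
    N16HolderAt c β :=
  covRootHolder_of_covRootHolderMS hL h

/-- **AT `β = 1`, `N16HolderMSAt c 1` IMPLIES THE VENUE DECL `N16At c`** (`c.L ≥ 1`). [folklore] -/
theorem n16At_of_n16HolderMSAt_one {N : ℕ} {c : NE3Carriers N} (h : N16HolderMSAt c 1) (hL : 1 ≤ c.L) : N16At c :=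
  (n16HolderAt_one_iff c).mp (n16HolderAt_of_n16HolderMSAt h hL)

section Stub

variable {N : ℕ} [NeZero N]

/-! ## §3 The MS analogue of the stub `S_N16` (CANDIDATE wording of R-β″; the stub of record untouched) -/

/-- **N16 · NE3 WITH THE MULTI-SCALE HÖLDER MEMBER AT EXPONENT `β`, BY NAME AT THE CARRIERS OF RECORD** — the R-β″ analogue of the stub
`YMDAG.UVSplit.S_N16 RRec`: for every family, datum, tuned bare sequence, loop string and rate-carrier bundle OF RECORD, `N16HolderMSAt R.ne3 β`.  Implies
generation 3's `S_N16Holder β RRec` when the record's bundles have block factor `≥ 1` (below).  A CANDIDATE wording; the stub of record is untouched. [folklore] -/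
@[folklore]
def S_N16HolderMS (β : ℝ) (RRec : RateRecordPred N) : Prop :=
  ∀ (F : T4Family) (D : Datum F N) (g₀ : ℕ → ℝ) (os : List (ULoop F)) (R : RateCarriers N), RRec F D g₀ os R → N16HolderMSAt R.ne3 β

/-- `S_N16HolderMS β RRec` unfolded (`Iff.rfl`). [folklore] -/
theorem s_N16HolderMS_iff (β : ℝ) (RRec : RateRecordPred N) :
    S_N16HolderMS β RRec ↔
      ∀ (F : T4Family) (D : Datum F N) (g₀ : ℕ → ℝ) (os : List (ULoop F)) (R : RateCarriers N), RRec F D g₀ os R → N16HolderMSAt R.ne3 β :=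
  Iff.rfl

/-- **`S_N16HolderMS β RRec` IMPLIES `S_N16Holder β RRec`**, provided the record's bundles have block factor `≥ 1` (THE END's regime of record has `2 ≤ c.L`).
[folklore] -/
theorem s_N16Holder_of_s_N16HolderMS {β : ℝ} {RRec : RateRecordPred N} (h : S_N16HolderMS β RRec)
    (hreg : ∀ (F : T4Family) (D : Datum F N) (g₀ : ℕ → ℝ) (os : List (ULoop F)) (R : RateCarriers N), RRec F D g₀ os R → 1 ≤ R.ne3.L) :
    S_N16Holder β RRec :=
  fun F D g₀ os R hR => n16HolderAt_of_n16HolderMSAt (h F D g₀ os R hR) (hreg F D g₀ os R hR)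

/-- **AT `β = 1`, `S_N16HolderMS 1 RRec` IMPLIES THE STUB OF RECORD `S_N16 RRec`** (block factor `≥ 1` on the record's bundles). [folklore] -/
theorem s_N16_of_s_N16HolderMS_one {RRec : RateRecordPred N} (h : S_N16HolderMS 1 RRec)
    (hreg : ∀ (F : T4Family) (D : Datum F N) (g₀ : ℕ → ℝ) (os : List (ULoop F)) (R : RateCarriers N), RRec F D g₀ os R → 1 ≤ R.ne3.L) :
    S_N16 RRec :=
  (s_N16Holder_one_iff RRec).mp (s_N16Holder_of_s_N16HolderMS h hreg)

end Stub

end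

end Summit.QuantumFields.YangMills.BalabanUVNodes.N16HolderMSDefs
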